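import Literature.LinearAlgebra.Matrix.LyapunovDecayRate
import HarnessLib

/-!
# The Lyapunov inequality on a connected parameter set forces `P ≻ 0` everywhere

Topic `Literature/LinearAlgebra/Matrix`. Companion of `LyapunovEquation.lean` / `LyapunovDecayRate.lean`
(Lyapunov's theorem: `P ≻ 0` and `−(JᵀP + PJ) ≻ 0` ⇒ `J` Hurwitz, with the quantitative rate
`Re μ ≤ −m/(2π)`), written for the parametric certificates of
`Literature/Analysis/ValidatedNumerics/ParametricLyapunovTaylorCertificate.lean`.

MAIN RESULT (`posDef_on_of_lyapunov_pos`). Let `S` be a preconnected set of parameters,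
`P : (Fin K → ℝ) → Matrix (Fin n) (Fin n) ℝ` continuous with `P(x)` symmetric, `J(x)` arbitrary real
matrices, and suppose the Lyapunov form `−wᵀ(J(x)ᵀP(x) + P(x)J(x))w` is positive for every `x ∈ S`
and every `w ≠ 0`. If `P(x₀) ≻ 0` at ONE point `x₀ ∈ S`, then `P(x) ≻ 0` at EVERY `x ∈ S` — so a
certificate for a parametric family needs positive definiteness of its Lyapunov matrix only at one
point per connected leaf, not on the whole leaf. Proof: the set where `P ≻ 0` is relatively open
(`exists_pos_mul_dotProduct_self_le_of_posDef`: a positive definite matrix is uniformly so, by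
compactness of the sup-norm unit sphere; plus `abs_dotProduct_mulVec_le_of_abs_entry_le`); the set
where `P ⪰ 0` is relatively closed and EQUALS the former on `S`, because a singular `P ⪰ 0` with
`Pv = 0`, `v ≠ 0` gives `vᵀ(JᵀP + PJ)v = 0` (`dotProduct_mulVec_pos_of_nonneg_of_lyapunov`, via
`mulVec_eq_zero_of_dotProduct_mulVec_eq_zero`); a non-empty relatively clopen subset of a
preconnected set is the whole set. This is the continuity half of the boundary-crossing argument of
parametric robust stability (eigenvalues cannot leave the open left half-plane without a singular
Lyapunov matrix); the proof here is elementary and self-contained.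

## What is NOT here

No claim about a common Lyapunov function (the conclusion is pointwise in `x`); no converse; the
continuity of `J` is not needed and not assumed.

## References

* [CarlsonSchneider1962] D. Carlson, H. Schneider, J. Math. Anal. Appl. 6 (1963) 430–446, § 1 —
  Lyapunov's theorem and the form identity at an eigenvector / kernel vector, the algebraic input of
  `dotProduct_mulVec_pos_of_nonneg_of_lyapunov`. [cite: CarlsonSchneider1962, § 1]
-/

open Finset Matrix

namespace Literature.LinearAlgebra.Matrix

/-! ### Forms and positive definiteness -/

/-- `0 ≤ vᵀv`. [folklore] -/
private theorem dotProduct_self_nonneg₇ {n : ℕ} (v : Fin n → ℝ) : 0 ≤ v ⬝ᵥ v :=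
  Finset.sum_nonneg fun i _ ↦ mul_self_nonneg (v i)

/-- `v ≠ 0 ⇒ 0 < vᵀv`. [folklore] -/
private theorem dotProduct_self_pos_of_ne_zero₇ {n : ℕ} {v : Fin n → ℝ} (hv : v ≠ 0) :
    0 < v ⬝ᵥ v := by
  obtain ⟨i, hi⟩ : ∃ i, v i ≠ 0 := by
    by_contra h; push Not at h; exact hv (funext h)
  exact lt_of_lt_of_le (mul_self_pos.2 hi) (Finset.single_le_sum (f := fun j ↦ v j * v j)
    (fun j _ ↦ mul_self_nonneg (v j)) (Finset.mem_univ i))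

/-- `Σ_i Σ_j (v_i² + v_j²)/2 = n · vᵀv`. [folklore] -/
private theorem sum_sum_sq_half {n : ℕ} (v : Fin n → ℝ) :
    ∑ i : Fin n, ∑ j : Fin n, (v i * v i + v j * v j) / 2 = (n : ℝ) * (v ⬝ᵥ v) := by
  have e1 : ∀ i j : Fin n, (v i * v i + v j * v j) / 2 = v i * v i / 2 + v j * v j / 2 :=
    fun i j ↦ by ring
  simp only [e1, Finset.sum_add_distrib, Finset.sum_const, Finset.card_univ, Fintype.card_fin,
    nsmul_eq_mul]
  rw [← Finset.mul_sum, ← mul_add, ← Finset.sum_add_distrib]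
  simp only [dotProduct]
  congr 1
  exact Finset.sum_congr rfl fun i _ ↦ by ring

/-- **Small entries, small form**: `|E_{ij}| ≤ η` for all entries ⇒ `|vᵀEv| ≤ η·n·vᵀv`. [folklore] -/
private theorem abs_dotProduct_mulVec_le_of_abs_entry_le {n : ℕ} {E : Matrix (Fin n) (Fin n) ℝ} {η : ℝ}
    (hη : 0 ≤ η) (hE : ∀ i j, |E i j| ≤ η) (v : Fin n → ℝ) :
    |v ⬝ᵥ (E *ᵥ v)| ≤ η * n * (v ⬝ᵥ v) := by
  have h1 : v ⬝ᵥ (E *ᵥ v) = ∑ i, ∑ j, E i j * (v i * v j) := by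
    simp only [dotProduct, mulVec, Finset.mul_sum]
    exact Finset.sum_congr rfl fun i _ ↦ Finset.sum_congr rfl fun j _ ↦ by ring
  rw [h1]
  refine (Finset.abs_sum_le_sum_abs _ _).trans ?_
  have h2 : ∀ i, |∑ j, E i j * (v i * v j)| ≤ ∑ j, η * ((v i * v i + v j * v j) / 2) := fun i ↦ by
    refine (Finset.abs_sum_le_sum_abs _ _).trans (Finset.sum_le_sum fun j _ ↦ ?_)
    rw [abs_mul, abs_mul]
    refine mul_le_mul (hE i j) ?_ (by positivity) hη
    have := two_mul_le_add_sq |v i| |v j|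
    rw [sq_abs, sq_abs, sq, sq] at this
    linarith
  refine (Finset.sum_le_sum fun i _ ↦ h2 i).trans (le_of_eq ?_)
  simp only [← Finset.mul_sum]
  rw [sum_sum_sq_half, mul_assoc]

/-- The form of a symmetric real matrix is symmetric: `aᵀPb = bᵀPa`. [folklore] -/
private theorem form_comm₆ {n : ℕ} {P : Matrix (Fin n) (Fin n) ℝ} (hP : P.IsSymm) (a b : Fin n → ℝ) :
    a ⬝ᵥ (P *ᵥ b) = b ⬝ᵥ (P *ᵥ a) := by
  rw [dotProduct_mulVec, ← Matrix.mulVec_transpose, hP.eq, dotProduct_comm]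

/-- A real symmetric matrix is Hermitian ⇒ symmetric (plumbing). [folklore] -/
private theorem isSymm_of_isHermitian₆ {n : ℕ} {P : Matrix (Fin n) (Fin n) ℝ} (h : P.IsHermitian) :
    P.IsSymm := by
  have := h.eq
  rwa [Matrix.conjTranspose_eq_transpose_of_trivial] at this

/-- **A positive semidefinite form vanishing at `v` has `Pv = 0`** (real symmetric `P`). [folklore] -/
private theorem mulVec_eq_zero_of_dotProduct_mulVec_eq_zero {n : ℕ} {P : Matrix (Fin n) (Fin n) ℝ}
    (hP : P.IsSymm) (h0 : ∀ w : Fin n → ℝ, 0 ≤ w ⬝ᵥ (P *ᵥ w)) {v : Fin n → ℝ}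
    (hv : v ⬝ᵥ (P *ᵥ v) = 0) : P *ᵥ v = 0 := by
  have hB : ∀ w : Fin n → ℝ, v ⬝ᵥ (P *ᵥ w) = 0 := by
    intro w
    set b := v ⬝ᵥ (P *ᵥ w) with hb
    set c := w ⬝ᵥ (P *ᵥ w) with hc
    have hc0 : 0 ≤ c := h0 w
    have hexp : ∀ t : ℝ, 0 ≤ 2 * t * b + t * t * c := fun t ↦ by
      have := h0 (v + t • w)
      rw [Matrix.mulVec_add, Matrix.mulVec_smul, add_dotProduct, dotProduct_add, dotProduct_add,
        dotProduct_smul, dotProduct_smul, smul_dotProduct, smul_dotProduct, hv, form_comm₆ hP w v]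
        at this
      simp only [smul_eq_mul] at this
      linarith
    by_contra hne
    have hc1 : 0 < c + 1 := by linarith
    have := hexp (-b / (c + 1))
    rw [show 2 * (-b / (c + 1)) * b + -b / (c + 1) * (-b / (c + 1)) * c
      = b * b * (-(c + 2)) / ((c + 1) * (c + 1)) by field_simp; ring] at this
    have hnum : b * b * (-(c + 2)) < 0 := by nlinarith [mul_self_pos.2 hne]
    have := div_neg_of_neg_of_pos hnum (mul_pos hc1 hc1)
    linarith
  funext j
  have h1 := hB (Pi.single j 1)
  rw [form_comm₆ hP, single_dotProduct, one_mul] at h1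
  exact h1

/-- **A singular `P ⪰ 0` cannot satisfy a strict Lyapunov inequality**: if `P` is real symmetric with
`wᵀPw ≥ 0` for all `w` and `−wᵀ(JᵀP + PJ)w > 0` for all `w ≠ 0`, then `vᵀPv > 0` for all `v ≠ 0`.
[cite: CarlsonSchneider1962, § 1 (Lyapunov's theorem: the form identity at a kernel vector)] -/
theorem dotProduct_mulVec_pos_of_nonneg_of_lyapunov {n : ℕ} {P J : Matrix (Fin n) (Fin n) ℝ}
    (hP : P.IsSymm) (h0 : ∀ w : Fin n → ℝ, 0 ≤ w ⬝ᵥ (P *ᵥ w))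
    (hQ : ∀ w : Fin n → ℝ, w ≠ 0 → 0 < -(w ⬝ᵥ ((Jᵀ * P + P * J) *ᵥ w))) {v : Fin n → ℝ}
    (hv : v ≠ 0) : 0 < v ⬝ᵥ (P *ᵥ v) := by
  rcases (h0 v).lt_or_eq with h | h
  · exact h
  · exfalso
    have hPv : P *ᵥ v = 0 := mulVec_eq_zero_of_dotProduct_mulVec_eq_zero hP h0 h.symm
    have := hQ v hv
    rw [Matrix.add_mulVec, ← Matrix.mulVec_mulVec, ← Matrix.mulVec_mulVec, hPv, Matrix.mulVec_zero,
      zero_add, form_comm₆ hP, hPv, dotProduct_zero, neg_zero] at this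
    exact lt_irrefl _ this

/-- **Positive definite ⇒ uniformly positive definite**: `∃ c > 0, c·vᵀv ≤ vᵀPv` for all `v`
(compactness of the unit sphere of the sup norm). [folklore] -/
private theorem exists_pos_mul_dotProduct_self_le_of_posDef {n : ℕ} {P : Matrix (Fin n) (Fin n) ℝ}
    (hP : P.PosDef) : ∃ c : ℝ, 0 < c ∧ ∀ v : Fin n → ℝ, c * (v ⬝ᵥ v) ≤ v ⬝ᵥ (P *ᵥ v) := by
  rcases Nat.eq_zero_or_pos n with hn | hn
  · subst hn
    refine ⟨1, one_pos, fun v ↦ ?_⟩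
    simp [dotProduct]
  · obtain ⟨m, rfl⟩ := Nat.exists_eq_succ_of_ne_zero hn.ne'
    let S : Set (Fin (m + 1) → ℝ) := Metric.sphere 0 1
    have hSc : IsCompact S := isCompact_sphere 0 1
    have hSne : S.Nonempty := (NormedSpace.sphere_nonempty).2 zero_le_one
    let f : (Fin (m + 1) → ℝ) → ℝ := fun u ↦ u ⬝ᵥ (P *ᵥ u)
    have hf : Continuous f := continuous_id.dotProduct (continuous_const.matrix_mulVec continuous_id)
    obtain ⟨u₀, hu₀S, hmin⟩ := hSc.exists_isMinOn hSne hf.continuousOn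
    have hu₀ : u₀ ≠ 0 := by
      intro h
      have : ‖u₀‖ = 1 := by simpa [S] using hu₀S
      rw [h, norm_zero] at this
      exact zero_ne_one this
    have hc₀ : 0 < f u₀ := by
      have := hP.dotProduct_mulVec_pos hu₀
      rwa [star_trivial] at this
    refine ⟨f u₀ / (m + 1 : ℕ), div_pos hc₀ (by exact_mod_cast hn), fun v ↦ ?_⟩
    by_cases hv : v = 0
    · subst hv; simp [dotProduct]
    · set t : ℝ := ‖v‖ with ht
      have htpos : 0 < t := norm_pos_iff.2 hv
      set u : Fin (m + 1) → ℝ := t⁻¹ • v with hu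
      have huS : u ∈ S := by
        show u ∈ Metric.sphere (0 : Fin (m + 1) → ℝ) 1
        rw [mem_sphere_zero_iff_norm, hu, norm_smul, norm_inv, Real.norm_eq_abs,
          abs_of_pos htpos, inv_mul_cancel₀ htpos.ne']
      have hfu : f u₀ ≤ f u := hmin huS
      have hvu : v = t • u := by rw [hu, smul_inv_smul₀ htpos.ne']
      have hfv : v ⬝ᵥ (P *ᵥ v) = t * t * f u := by
        show v ⬝ᵥ (P *ᵥ v) = t * t * (u ⬝ᵥ (P *ᵥ u))
        rw [hvu, Matrix.mulVec_smul, smul_dotProduct, dotProduct_smul, smul_eq_mul, smul_eq_mul]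
        ring
      have hvv : v ⬝ᵥ v ≤ ((m + 1 : ℕ) : ℝ) * (t * t) := by
        have h1 : ∀ i, v i * v i ≤ t * t := fun i ↦ by
          have hi : |v i| ≤ t := by rw [ht, ← Real.norm_eq_abs]; exact norm_le_pi_norm v i
          calc v i * v i = |v i| * |v i| := (abs_mul_abs_self (v i)).symm
            _ ≤ t * t := mul_le_mul hi hi (abs_nonneg _) htpos.le
        calc v ⬝ᵥ v = ∑ i, v i * v i := rfl
          _ ≤ ∑ _i : Fin (m + 1), t * t := Finset.sum_le_sum fun i _ ↦ h1 i
          _ = ((m + 1 : ℕ) : ℝ) * (t * t) := by simp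
      have hm : (0 : ℝ) < ((m + 1 : ℕ) : ℝ) := by exact_mod_cast hn
      calc f u₀ / ((m + 1 : ℕ) : ℝ) * (v ⬝ᵥ v)
          ≤ f u₀ / ((m + 1 : ℕ) : ℝ) * (((m + 1 : ℕ) : ℝ) * (t * t)) :=
            mul_le_mul_of_nonneg_left hvv (div_pos hc₀ hm).le
        _ = t * t * f u₀ := by field_simp
        _ ≤ t * t * f u := mul_le_mul_of_nonneg_left hfu (mul_pos htpos htpos).le
        _ = v ⬝ᵥ (P *ᵥ v) := hfv.symm

/-- **Lyapunov inequality on a connected parameter set.** Let `S` be a preconnected set of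
parameters, `P : S → Sym_n(ℝ)` continuous (Hermitian at every point), and suppose the Lyapunov form
`−wᵀ(J(x)ᵀP(x) + P(x)J(x))w` is positive for every `x ∈ S` and `w ≠ 0`. If `P(x₀) ≻ 0` at ONE point
`x₀ ∈ S` then `P(x) ≻ 0` at EVERY `x ∈ S` (hence, by Lyapunov's theorem, `J(x)` is Hurwitz on `S`).
Proof: `{P ≻ 0}` is relatively open (uniform bound + continuity), `{P ⪰ 0}` is relatively closed and
equals `{P ≻ 0}` on `S` by `dotProduct_mulVec_pos_of_nonneg_of_lyapunov`; preconnectedness.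
[cite: CarlsonSchneider1962, § 1 (Lyapunov's theorem); continuity argument folklore in parametric
robust stability] -/
theorem posDef_on_of_lyapunov_pos {K n : ℕ} {S : Set (Fin K → ℝ)} (hS : IsPreconnected S)
    {P J : (Fin K → ℝ) → Matrix (Fin n) (Fin n) ℝ} (hPc : Continuous P)
    (hPs : ∀ x, (P x).IsHermitian)
    (hQ : ∀ x ∈ S, ∀ w : Fin n → ℝ, w ≠ 0 → 0 < -(w ⬝ᵥ (((J x)ᵀ * P x + P x * J x) *ᵥ w)))
    {x₀ : Fin K → ℝ} (hx₀ : x₀ ∈ S) (hP₀ : (P x₀).PosDef) : ∀ x ∈ S, (P x).PosDef := by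
  let U : Set (Fin K → ℝ) :=
    {x | ∃ c : ℝ, 0 < c ∧ ∀ v : Fin n → ℝ, c * (v ⬝ᵥ v) ≤ v ⬝ᵥ (P x *ᵥ v)}
  let V : Set (Fin K → ℝ) := ⋃ v : Fin n → ℝ, {x | v ⬝ᵥ (P x *ᵥ v) < 0}
  have hUo : IsOpen U := by
    rw [isOpen_iff_mem_nhds]
    rintro x ⟨c, hc, hcx⟩
    set η : ℝ := c / (2 * ((n : ℝ) + 1)) with hη
    have hηpos : 0 < η := by positivity
    have hev : ∀ᶠ y in nhds x, ∀ i j : Fin n, |P y i j - P x i j| < η := by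
      refine Filter.eventually_all.2 fun i ↦ Filter.eventually_all.2 fun j ↦ ?_
      have hg : Continuous fun y ↦ |P y i j - P x i j| :=
        ((hPc.matrix_elem i j).sub continuous_const).abs
      have h0 : (fun y ↦ |P y i j - P x i j|) x < (fun _ ↦ η) x := by simp [hηpos]
      exact hg.continuousAt.eventually_lt continuousAt_const h0
    refine Filter.mem_of_superset hev fun y hy ↦ ?_
    refine ⟨c / 2, by positivity, fun v ↦ ?_⟩
    have hsplit : v ⬝ᵥ (P y *ᵥ v) = v ⬝ᵥ (P x *ᵥ v) + v ⬝ᵥ ((P y - P x) *ᵥ v) := by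
      rw [Matrix.sub_mulVec, dotProduct_sub]; ring
    have hE := abs_dotProduct_mulVec_le_of_abs_entry_le (E := P y - P x) hηpos.le
      (fun i j ↦ by rw [Matrix.sub_apply]; exact (hy i j).le) v
    have hvv : 0 ≤ v ⬝ᵥ v := dotProduct_self_nonneg₇ v
    have hηn : η * n * (v ⬝ᵥ v) ≤ c / 2 * (v ⬝ᵥ v) := by
      refine mul_le_mul_of_nonneg_right ?_ hvv
      rw [hη, div_mul_eq_mul_div, div_le_div_iff₀ (by positivity) (by positivity)]
      nlinarith
    have := hcx v
    rw [hsplit]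
    have h3 := neg_abs_le (v ⬝ᵥ ((P y - P x) *ᵥ v))
    linarith
  have hVo : IsOpen V :=
    isOpen_iUnion fun v ↦ isOpen_lt (continuous_const.dotProduct (hPc.matrix_mulVec continuous_const))
      continuous_const
  have hU_of_pd : ∀ x, (P x).PosDef → x ∈ U := fun x hx ↦
    exists_pos_mul_dotProduct_self_le_of_posDef hx
  have hpd_of_psd : ∀ x ∈ S, (∀ v : Fin n → ℝ, 0 ≤ v ⬝ᵥ (P x *ᵥ v)) → (P x).PosDef :=
    fun x hx h0 ↦ Matrix.PosDef.of_dotProduct_mulVec_pos (hPs x) fun v hv ↦ by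
      rw [star_trivial]
      exact dotProduct_mulVec_pos_of_nonneg_of_lyapunov (isSymm_of_isHermitian₆ (hPs x)) h0
        (hQ x hx) hv
  have hcover : S ⊆ U ∪ V := fun x hx ↦ by
    by_cases h : ∃ v : Fin n → ℝ, v ⬝ᵥ (P x *ᵥ v) < 0
    · exact Or.inr (Set.mem_iUnion.2 h)
    · push Not at h
      exact Or.inl (hU_of_pd x (hpd_of_psd x hx h))
  have hSU : (S ∩ U).Nonempty := ⟨x₀, hx₀, hU_of_pd x₀ hP₀⟩
  have hSV : ¬ (S ∩ V).Nonempty := fun hne ↦ by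
    obtain ⟨z, -, ⟨c, hc, hcz⟩, hzV⟩ := hS U V hUo hVo hcover hSU hne
    obtain ⟨v, hv⟩ := Set.mem_iUnion.1 hzV
    have h1 := hcz v
    have h2 : 0 ≤ c * (v ⬝ᵥ v) := mul_nonneg hc.le (dotProduct_self_nonneg₇ v)
    have h3 : v ⬝ᵥ (P z *ᵥ v) < 0 := hv
    linarith
  intro x hx
  rcases hcover hx with hxU | hxV
  · obtain ⟨c, hc, hcx⟩ := hxU
    refine Matrix.PosDef.of_dotProduct_mulVec_pos (hPs x) fun v hv ↦ ?_
    rw [star_trivial]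
    exact lt_of_lt_of_le (mul_pos hc (dotProduct_self_pos_of_ne_zero₇ hv)) (hcx v)
  · exact absurd ⟨x, hx, hxV⟩ hSV

end Literature.LinearAlgebra.Matrix
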